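import Summits.CriticalPhenomena.SAWScalingLimit.Theorems.SAWDefectDecoherenceMassRatioOccupationIdentity

/-!
# One-sided domain Markov property at a mid-edge, converse half: cutting, and the exact occupation identity
(crux `MassRatio`, stmt-CriticalPhenomena-8550; STRATEGY-CENSUS §4.2)

Continuation of `SAWDefectDecoherenceMassRatioOccupationIdentity.lean` (gluing `γ : a → e` with a
continuation `ω : e → b` of the slit domain `Λ ∖ γ`, injective at fixed `e`). Here the converse:
every self-avoiding walk `Ω ⊂ Ω : a → b` that STEPS THROUGH the mid-edge `e` (i.e. `e` is one of the
consecutive pairs of its vertex list) is glued from such a pair — cut it at that step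
(`Occupation.cut`). Consequently the gluing is a bijection onto the walks through `e`, and for every
real `x`
  `Σ_{γ ⊂ Ω : a → e} x^{ℓ(γ)} · Σ_{ω ⊂ Ω∖γ : e → b} x^{ℓ(ω)} = Σ_{Ω ⊂ Ω : a → b, e ∈ steps(Ω)} x^{ℓ(Ω)}`
(`sum_mul_sum_slit_eq`), and, summed over a finite set `S` of mid-edges avoiding `a, b`, the exact
OCCUPATION (two-leg fusion) IDENTITY
  `Σ_{e ∈ S} Σ_{γ : a → e} x^{ℓ(γ)} · Σ_{ω ⊂ Ω∖γ : e → b} x^{ℓ(ω)} = Σ_{Ω : a → b} N_S(Ω) · x^{ℓ(Ω)}`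
with `N_S(Ω) = #{e ∈ S : e ∈ steps(Ω)}` the number of steps of `Ω` in `S` (`sum_sum_mul_sum_slit_eq`);
for the spin-`0` observable (`x ≥ 0`),
`Σ_{e∈S} Σ_{γ:a→e} x^{ℓ(γ)} ‖F^{Λ∖γ}_{x,0}(e→b)‖ = Σ_{Ω:a→b} N_S(Ω) x^{ℓ(Ω)}` (`occupation_eq_sum_card_mul`).
Pure combinatorics of vertex lists (Duminil-Copin–Smirnov 2012 §2; Madras–Slade 1993 §1.2); cut-,
spin- and frame-independent.

Deliberately NOT here: anything metric or asymptotic; bounds on `N_S`.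
-/

noncomputable section

namespace Summit.CriticalPhenomena.SAWScalingLimit.Theorems.MassRatio.Occupation

open Literature.Probability.LatticeModels Literature.Probability.RandomPlanarGeometry
open Literature.Probability.RandomPlanarGeometry.SAW
open Summit.CriticalPhenomena.SAWScalingLimit.Theorems.MassRatio.Negative

variable {Λ : Finset HexVertex} {a b e : Sym2 HexVertex}

/-! ### Locating a step -/

/-- A consecutive pair of a list splits the list around it: if `e` is one of the consecutive pairs
of `L`, then `L = l₁ ++ v :: w :: l₂` with `e = s(v, w)`. [folklore] -/
theorem exists_split_of_mem_edges : ∀ (L : List HexVertex),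
    e ∈ List.zipWith (fun x y => s(x, y)) L L.tail →
      ∃ (l₁ : List HexVertex) (v w : HexVertex) (l₂ : List HexVertex),
        L = l₁ ++ v :: w :: l₂ ∧ e = s(v, w)
  | [], he => by simp at he
  | [_], he => by simp at he
  | x :: y :: l, he => by
    rw [edges_cons_cons, List.mem_cons] at he
    rcases he with he | he
    · exact ⟨[], x, y, l, rfl, he⟩
    · obtain ⟨l₁, v, w, l₂, hl, he⟩ := exists_split_of_mem_edges (y :: l) he
      exact ⟨x :: l₁, v, w, l₂, by rw [hl]; rfl, he⟩

/-- The consecutive pairs of a glued list `l₁ ++ [v] ++ w :: l₂` contain the junction pair `s(v, w)`.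
[folklore] -/
theorem mem_edges_glued (l₁ l₂ : List HexVertex) (v w : HexVertex) :
    s(v, w) ∈ List.zipWith (fun x y => s(x, y)) (l₁ ++ [v] ++ w :: l₂)
      (l₁ ++ [v] ++ w :: l₂).tail := by
  rw [List.append_assoc, List.singleton_append, Renewal.RenewalCut.edges_append_cons_cons]
  exact List.mem_append_right _ List.mem_cons_self

/-! ### Cutting -/

/-- **Cutting (converse of `glue`).** A self-avoiding walk `Ω ⊂ Ω : a → b` whose vertex list reads
`l₁ ++ v :: w :: l₂` is glued from the walk `a → s(v, w)` with vertex list `l₁ ++ [v]` and the walk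
`s(v, w) → b` of the slit domain `Λ ∖ (l₁ ++ [v])` with vertex list `w :: l₂`.
[cite: DuminilCopinSmirnov2012, §2 (domain Markov property)] -/
theorem cut (Ω : HexMidEdgeSAW Λ a b) {l₁ l₂ : List HexVertex} {v w : HexVertex}
    (hL : Ω.verts = l₁ ++ v :: w :: l₂) :
    ∃ (γ : HexMidEdgeSAW Λ a s(v, w)) (ω : HexMidEdgeSAW (Λ \ γ.verts.toFinset) s(v, w) b),
      γ.verts = l₁ ++ [v] ∧ ω.verts = w :: l₂ := by
  have hL' : Ω.verts = (l₁ ++ [v]) ++ w :: l₂ := by rw [hL, List.append_assoc]; rfl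
  have hγne : l₁ ++ [v] ≠ [] := by simp
  have hωne : w :: l₂ ≠ [] := List.cons_ne_nil _ _
  -- the supports are disjoint, each duplicate-free and a chain; the junction is adjacent
  have hnd := Ω.nodup
  rw [hL'] at hnd
  obtain ⟨hγnd, hωnd, hdis⟩ := List.nodup_append.1 hnd
  have hch := Ω.isChain
  rw [hL'] at hch
  obtain ⟨hγch, hωch, hjct⟩ := List.isChain_append.1 hch
  have hadj : hexGraph.Adj v w :=
    hjct v (by rw [Option.mem_def, List.getLast?_concat]) w (by rw [Option.mem_def, List.head?_cons])
  -- the edge list of `Ω` splits accordingly: prefix `a, pairs(l₁ ++ [v]), e`, suffix `e, pairs(w :: l₂), b`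
  have hE := Ω.edges_nodup (by rw [hL']; simp)
  rw [hL', List.append_assoc, List.singleton_append, Renewal.RenewalCut.edges_append_cons_cons]
    at hE
  have hpre : ((a :: List.zipWith (fun x y => s(x, y)) (l₁ ++ [v]) (l₁ ++ [v]).tail ++ [s(v, w)]) ++
      (List.zipWith (fun x y => s(x, y)) (w :: l₂) (w :: l₂).tail ++ [b])).Nodup := by
    simpa only [List.cons_append, List.append_assoc, List.singleton_append, List.nil_append] using hE
  have hsuf : ((a :: List.zipWith (fun x y => s(x, y)) (l₁ ++ [v]) (l₁ ++ [v]).tail) ++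
      (s(v, w) :: List.zipWith (fun x y => s(x, y)) (w :: l₂) (w :: l₂).tail ++ [b])).Nodup := by
    simpa only [List.cons_append, List.append_assoc] using hE
  refine ⟨⟨l₁ ++ [v], fun x hx => Ω.subset x (by rw [hL']; exact List.mem_append_left _ hx), hγnd,
    hγch, ?_, ?_, fun h => (hγne h).elim, fun _ => (List.nodup_append.1 hpre).1, Ω.fst_mem⟩, ?_⟩
  · -- starts on `a`
    intro x hx
    refine Ω.head_mem x ?_
    rw [hL', List.head?_append, hx, Option.some_or]
  · -- ends on `s(v, w)`
    intro x hx
    rw [List.getLast?_concat, Option.some_inj] at hx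
    rw [← hx]
    exact Sym2.mem_mk_left _ _
  -- the continuation in the slit domain
  refine ⟨⟨w :: l₂, ?_, hωnd, hωch, ?_, ?_, fun h => (hωne h).elim,
    fun _ => (List.nodup_append.1 hsuf).2.1, ?_⟩, rfl, rfl⟩
  · -- stays in the slit domain
    intro x hx
    refine Finset.mem_sdiff.2 ⟨Ω.subset x (by rw [hL']; exact List.mem_append_right _ hx), ?_⟩
    intro hx'
    exact hdis x (List.mem_toFinset.1 hx') x hx rfl
  · -- starts on `s(v, w)`
    intro x hx
    rw [List.head?_cons, Option.some_inj] at hx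
    rw [← hx]
    exact Sym2.mem_mk_right _ _
  · -- ends on `b`
    intro x hx
    refine Ω.getLast_mem x ?_
    rw [hL', List.getLast?_append, hx, Option.some_or]
  · -- `s(v, w)` is a mid-edge of the slit domain: `w` is in it
    refine ⟨(SimpleGraph.mem_edgeSet _).2 hadj, w, Sym2.mem_mk_right _ _, Finset.mem_sdiff.2 ⟨?_, ?_⟩⟩
    · exact Ω.subset w (by rw [hL']; exact List.mem_append_right _ List.mem_cons_self)
    · intro hw
      exact hdis w (List.mem_toFinset.1 hw) w List.mem_cons_self rfl

/-- **The walks through `e` are exactly the glued ones** (on vertex lists): for a boundary mid-edge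
`b ∈ ∂Ω` and a mid-edge `e ≠ a, b`, the vertex lists `γ.verts ++ ω.verts` of the glued pairs are
exactly the vertex lists of the walks `a → b` having `e` among their steps. [cite: DuminilCopinSmirnov2012, §2 (domain Markov property)] -/
theorem image_glue_eq [DecidableEq (HexMidEdgeSAW Λ a b)]
    [DecidablePred fun Ω : HexMidEdgeSAW Λ a b =>
      e ∈ List.zipWith (fun x y => s(x, y)) Ω.verts Ω.verts.tail]
    (hb : b ∈ hexDomainBoundary Λ) (hea : e ≠ a) (heb : e ≠ b) :
    (Finset.univ : Finset (Σ γ : HexMidEdgeSAW Λ a e,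
        HexMidEdgeSAW (Λ \ γ.verts.toFinset) e b)).image (fun p => p.1.verts ++ p.2.verts) =
      ((Finset.univ : Finset (HexMidEdgeSAW Λ a b)).filter
        (fun Ω => e ∈ List.zipWith (fun x y => s(x, y)) Ω.verts Ω.verts.tail)).image
          HexMidEdgeSAW.verts := by
  have hγne : ∀ γ : HexMidEdgeSAW Λ a e, γ.verts ≠ [] := fun γ =>
    verts_ne_nil_of_ne γ (Ne.symm hea)
  have hωne : ∀ (γ : HexMidEdgeSAW Λ a e) (ω : HexMidEdgeSAW (Λ \ γ.verts.toFinset) e b),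
      ω.verts ≠ [] := fun γ ω => verts_ne_nil_of_ne ω heb
  ext L
  simp only [Finset.mem_image, Finset.mem_univ, true_and, Finset.mem_filter]
  constructor
  · rintro ⟨⟨γ, ω⟩, rfl⟩
    obtain ⟨Ω, hΩ⟩ := glue hb γ (hγne γ) ω (hωne γ ω)
    refine ⟨Ω, ?_, hΩ⟩
    obtain ⟨-, he, -⟩ := cut_eq γ (hγne γ) ω (hωne γ ω)
    -- write `γ.verts = l₁ ++ [v]`, `ω.verts = w :: l₂` with `e = s(v, w)`
    obtain ⟨l₁, v, hT⟩ : ∃ (l₁ : List HexVertex) (v : HexVertex), γ.verts = l₁ ++ [v] :=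
      ⟨_, _, (List.dropLast_append_getLast (hγne γ)).symm⟩
    obtain ⟨w, l₂, hD⟩ := List.exists_cons_of_ne_nil (hωne γ ω)
    have hv : γ.verts.getLast (hγne γ) = v := by
      have h1 : γ.verts.getLast? = some v := by rw [hT, List.getLast?_concat]
      have h2 := List.getLast?_eq_some_getLast (hγne γ)
      rw [h1, Option.some_inj] at h2
      exact h2.symm
    have hw : ω.verts.head (hωne γ ω) = w := by
      have h1 : ω.verts.head? = some w := by rw [hD, List.head?_cons]
      have h2 := List.head?_eq_some_head (hωne γ ω)
      rw [h1, Option.some_inj] at h2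
      exact h2.symm
    rw [hv, hw] at he
    rw [hΩ, hD, hT, he]
    exact mem_edges_glued _ _ _ _
  · rintro ⟨Ω, hmem, rfl⟩
    obtain ⟨l₁, v, w, l₂, hL, he⟩ := exists_split_of_mem_edges Ω.verts hmem
    subst he
    obtain ⟨γ, ω, hγ, hω⟩ := cut Ω hL
    refine ⟨⟨γ, ω⟩, ?_⟩
    show γ.verts ++ ω.verts = Ω.verts
    rw [hω, hγ, hL, List.append_assoc]
    rfl

/-! ### The exact identity at a fixed mid-edge -/

open scoped Classical in
/-- **The factorised mass through `e` IS the mass of the walks `a → b` stepping through `e`.** For a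
boundary mid-edge `b ∈ ∂Ω`, a mid-edge `e ≠ a, b` and any real `x`:
`Σ_{γ ⊂ Ω : a → e} x^{ℓ(γ)} · Σ_{ω ⊂ Ω∖γ : e → b} x^{ℓ(ω)} = Σ_{Ω ⊂ Ω : a → b, e ∈ steps(Ω)} x^{ℓ(Ω)}`
(gluing is a length-additive bijection onto the walks through `e`: `glue`, `glue_inj`, `cut`).
[cite: DuminilCopinSmirnov2012, §2 (domain Markov property)] -/
theorem sum_mul_sum_slit_eq (hb : b ∈ hexDomainBoundary Λ) (hea : e ≠ a) (heb : e ≠ b) (x : ℝ) :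
    ∑ γ : HexMidEdgeSAW Λ a e, x ^ γ.length *
        ∑ ω : HexMidEdgeSAW (Λ \ γ.verts.toFinset) e b, x ^ ω.length =
      ∑ Ω ∈ (Finset.univ : Finset (HexMidEdgeSAW Λ a b)).filter
          (fun Ω => e ∈ List.zipWith (fun x y => s(x, y)) Ω.verts Ω.verts.tail), x ^ Ω.length := by
  have hγne : ∀ γ : HexMidEdgeSAW Λ a e, γ.verts ≠ [] := fun γ =>
    verts_ne_nil_of_ne γ (Ne.symm hea)
  have hωne : ∀ (γ : HexMidEdgeSAW Λ a e) (ω : HexMidEdgeSAW (Λ \ γ.verts.toFinset) e b),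
      ω.verts ≠ [] := fun γ ω => verts_ne_nil_of_ne ω heb
  have hinj : ∀ p ∈ (Finset.univ : Finset (Σ γ : HexMidEdgeSAW Λ a e,
      HexMidEdgeSAW (Λ \ γ.verts.toFinset) e b)), ∀ q ∈ (Finset.univ : Finset
        (Σ γ : HexMidEdgeSAW Λ a e, HexMidEdgeSAW (Λ \ γ.verts.toFinset) e b)),
      p.1.verts ++ p.2.verts = q.1.verts ++ q.2.verts → p = q := by
    rintro ⟨γ, ω⟩ - ⟨γ', ω'⟩ - heq
    obtain ⟨h1, h2⟩ := glue_inj γ γ' (hγne γ) (hγne γ') ω (hωne γ ω) ω' (hωne γ' ω') heq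
    obtain rfl : γ = γ' := HexMidEdgeSAW.ext h1
    obtain rfl : ω = ω' := HexMidEdgeSAW.ext h2
    rfl
  calc ∑ γ : HexMidEdgeSAW Λ a e, x ^ γ.length *
          ∑ ω : HexMidEdgeSAW (Λ \ γ.verts.toFinset) e b, x ^ ω.length
      = ∑ p : (Σ γ : HexMidEdgeSAW Λ a e, HexMidEdgeSAW (Λ \ γ.verts.toFinset) e b),
          x ^ (p.1.verts ++ p.2.verts).length := by
        rw [Fintype.sum_sigma]
        refine Finset.sum_congr rfl fun γ _ => ?_
        rw [Finset.mul_sum]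
        refine Finset.sum_congr rfl fun ω _ => ?_
        rw [List.length_append, pow_add]
        rfl
    _ = ∑ L ∈ (Finset.univ : Finset (Σ γ : HexMidEdgeSAW Λ a e,
          HexMidEdgeSAW (Λ \ γ.verts.toFinset) e b)).image (fun p => p.1.verts ++ p.2.verts),
            x ^ L.length :=
        (Finset.sum_image (f := fun L : List HexVertex => x ^ L.length) hinj).symm
    _ = ∑ Ω ∈ (Finset.univ : Finset (HexMidEdgeSAW Λ a b)).filter
          (fun Ω => e ∈ List.zipWith (fun x y => s(x, y)) Ω.verts Ω.verts.tail), x ^ Ω.length := by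
        rw [image_glue_eq hb hea heb, Finset.sum_image fun Ω _ Ω' _ h => HexMidEdgeSAW.ext h]
        rfl

/-! ### The occupation identity -/

open scoped Classical in
/-- **The occupation (two-leg fusion) identity.** For a boundary mid-edge `b ∈ ∂Ω`, a finite set `S`
of mid-edges avoiding `a` and `b`, and any real `x`:
`Σ_{e ∈ S} Σ_{γ ⊂ Ω : a → e} x^{ℓ(γ)} · Σ_{ω ⊂ Ω∖γ : e → b} x^{ℓ(ω)} = Σ_{Ω ⊂ Ω : a → b} N_S(Ω) · x^{ℓ(Ω)}`,
where `N_S(Ω) = #{e ∈ S : e ∈ steps(Ω)}` counts the steps of `Ω` inside `S` (each at most once: the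
steps of a self-avoiding walk are pairwise distinct). [cite: DuminilCopinSmirnov2012, §2 (domain Markov property)] -/
theorem sum_sum_mul_sum_slit_eq (hb : b ∈ hexDomainBoundary Λ) (S : Finset (Sym2 HexVertex))
    (haS : a ∉ S) (hbS : b ∉ S) (x : ℝ) :
    ∑ e ∈ S, ∑ γ : HexMidEdgeSAW Λ a e, x ^ γ.length *
        ∑ ω : HexMidEdgeSAW (Λ \ γ.verts.toFinset) e b, x ^ ω.length =
      ∑ Ω : HexMidEdgeSAW Λ a b,
        (S.filter (fun e => e ∈ List.zipWith (fun x y => s(x, y)) Ω.verts Ω.verts.tail)).card *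
          x ^ Ω.length := by
  calc ∑ e ∈ S, ∑ γ : HexMidEdgeSAW Λ a e, x ^ γ.length *
          ∑ ω : HexMidEdgeSAW (Λ \ γ.verts.toFinset) e b, x ^ ω.length
      = ∑ e ∈ S, ∑ Ω : HexMidEdgeSAW Λ a b,
          (if e ∈ List.zipWith (fun x y => s(x, y)) Ω.verts Ω.verts.tail then x ^ Ω.length
            else 0) := by
        refine Finset.sum_congr rfl fun e he => ?_
        rw [sum_mul_sum_slit_eq hb (ne_of_mem_of_not_mem he haS) (ne_of_mem_of_not_mem he hbS),
          Finset.sum_filter]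
    _ = ∑ Ω : HexMidEdgeSAW Λ a b, ∑ e ∈ S,
          (if e ∈ List.zipWith (fun x y => s(x, y)) Ω.verts Ω.verts.tail then x ^ Ω.length
            else 0) := Finset.sum_comm
    _ = ∑ Ω : HexMidEdgeSAW Λ a b,
          (S.filter (fun e => e ∈ List.zipWith (fun x y => s(x, y)) Ω.verts Ω.verts.tail)).card *
            x ^ Ω.length := by
        refine Finset.sum_congr rfl fun Ω _ => ?_
        rw [← Finset.sum_filter, Finset.sum_const, nsmul_eq_mul]

open scoped Classical in
/-- **The occupation identity for the spin-`0` parafermionic observable** (`Z = ‖F_{x,0}‖`): for a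
boundary mid-edge `b ∈ ∂Ω`, a finite set `S` of mid-edges avoiding `a` and `b`, and `x ≥ 0`, the mass
of the walks from `a` into `S`, each weighted by the continuation mass from its tip mid-edge to `b` in
its own slit domain, equals the `N_S`-weighted mass of the walks `a → b`:
`Σ_{e ∈ S} Σ_{γ ⊂ Ω : a → e} x^{ℓ(γ)} ‖F^{Λ∖γ}_{x,0}(e → b)‖ = Σ_{Ω ⊂ Ω : a → b} N_S(Ω) x^{ℓ(Ω)}`.
[cite: DuminilCopinSmirnov2012, §2 (domain Markov property)] -/
theorem occupation_eq_sum_card_mul : ∀ (Λ : Finset HexVertex) (a b : Sym2 HexVertex), b ∈ hexDomainBoundary Λ → ∀ (S : Finset (Sym2 HexVertex)), a ∉ S → b ∉ S → ∀ (x : ℝ), 0 ≤ x → ∑ e ∈ S, ∑ γ : HexMidEdgeSAW Λ a e, x ^ γ.length * ‖hexParafermionicObservable (Λ \ γ.verts.toFinset) e x 0 b‖ = ∑ Ω : HexMidEdgeSAW Λ a b, ((S.filter (fun e => e ∈ List.zipWith (fun x y => s(x, y)) Ω.verts Ω.verts.tail)).card : ℝ) * x ^ Ω.length := by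
  intro Λ a b hb S haS hbS x hx
  rw [← sum_sum_mul_sum_slit_eq hb S haS hbS]
  refine Finset.sum_congr rfl fun e _ => Finset.sum_congr rfl fun γ _ => ?_
  rw [norm_Z_eq_sum _ _ _ hx]

end Summit.CriticalPhenomena.SAWScalingLimit.Theorems.MassRatio.Occupation
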